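import Mathlib
import Summits.Ventures.PercRepro2.SwOutMixedArmsBlockLower

/-!
# The several-arms raw cube under the GEOMETRIC closure: vocabulary and moves (blind cell
PercRepro2, night-4 g21, 2026-08-27; proofs/NIGHT4-G21.md §1)

The pulled-back conditioning of a several-arms base is NOT block-lower (`not_blockLower_X`,
NIGHT4-G20.md §4″), but it IS closed under the raw-lower moves with the u–p condition
(`MixedBaseR.mem_tgtU_of_le`: every u–p_r class that turns blue does so with some u-arm red
before and some u-arm blue after) and under raising `uP` with the other coordinates fixed
(`MixedBaseR.mem_tgtU_of_uP_le`).  This file states that closure abstractly (`ArmLower`,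
`RaiseUP`) and proves, for PURE arms (no pieces: `IsEmpty ν`), the reachability lemmas the
big-block lemma under this closure needs: a T-slab point `(⊤, A, B, f)` reaches `(⊤, B, B, f)`,
then `(⊥, B ∖ A, B ∖ A, f)` (legal: a u-arm is red before and blue after), then
`(⊥, Aᶜ, B ∖ A, f)` — the injection `phiOff` of the off-diagonal T-slab into the B-slab, whose
`f`-frozen blue set is the red set of the source (`EBT_phiOff`); and a point with a red u-arm
reaches every `(s, C, C, f')` below it with a blue u-arm (`mem_diag_of_red`) and every
`(⊥, C, ⊥, f')` (`mem_botPt_of_red`).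
-/

namespace Summit.Ventures.PercRepro2

namespace MixedArms

open scoped Classical

variable {ι ρ ν κ : Type*}

section Closure

variable (arm : ν → ρ) (Q : Set (PtR ι ρ ν κ))

/-- **The raw-lower moves with the u–p condition** between non-leaking points: `q ≤ p`, and every
u–p_r class that turns blue does so with some u-arm red at `p` and some u-arm blue at `q` (the
hypothesis `huP` of `MixedBaseR.mem_tgtU_of_le`). -/
def ArmLower : Prop :=
  ∀ p q, ¬ Leak p arm → ¬ Leak q arm → q ≤ p →
    (∀ r, q.2.2.1 r = p.2.2.1 r ∨ ((∃ j, p.1 j = true) ∧ ∃ j, q.1 j = false)) → p ∈ Q → q ∈ Q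

/-- **Raising `uP`** with `s`, `a`, `e`, `f` fixed, between non-leaking points (the move of
`MixedBaseR.mem_tgtU_of_uP_le`). -/
def RaiseUP : Prop :=
  ∀ p q, ¬ Leak p arm → ¬ Leak q arm → q.1 = p.1 → q.2.1 = p.2.1 → p.2.2.1 ≤ q.2.2.1 →
    q.2.2.2.1 = p.2.2.2.1 → q.2.2.2.2 = p.2.2.2.2 → p ∈ Q → q ∈ Q

variable {arm Q}

/-- A lower set (between non-leaking points) is closed under the raw-lower moves with the u–p
condition. -/
lemma ArmLower.of_blockLower (hQ : BlockLower arm Q) : ArmLower arm Q :=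
  fun p q hp hq hle _ hpQ => hQ p q hp hq hle hpQ

end Closure

section Pure

variable [IsEmpty ν] {arm : ν → ρ}

/-- The unique piece configuration when there are no pieces. -/
def a0 : Config ν := fun i => isEmptyElim i

/-- Every piece configuration is `a0` when there are no pieces. -/
lemma config_eq_a0 (a : Config ν) : a = a0 := Subsingleton.elim _ _

/-- Without pieces, an arm leaks iff `p_r` is attached on one side with its outside edges on the
other side. -/
lemma leakArm_iff_pure (p : PtR ι ρ ν κ) (r : ρ) :
    LeakArm p arm r ↔
      ((∃ j, p.1 j = true) ∧ p.2.2.1 r = true ∧ p.2.2.2.1 r = false) ∨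
        ((∃ j, p.1 j = false) ∧ p.2.2.1 r = false ∧ p.2.2.2.1 r = true) := by
  simp only [LeakArm]
  constructor
  · rintro (⟨hs, hu, he | ⟨i, -⟩⟩ | ⟨hs, hu, he | ⟨i, -⟩⟩)
    · exact Or.inl ⟨hs, hu, he⟩
    · exact isEmptyElim i
    · exact Or.inr ⟨hs, hu, he⟩
    · exact isEmptyElim i
  · rintro (⟨hs, hu, he⟩ | ⟨hs, hu, he⟩)
    · exact Or.inl ⟨hs, hu, Or.inl he⟩
    · exact Or.inr ⟨hs, hu, Or.inl he⟩

/-- Without pieces, a point is non-leaking iff at every arm `uP_r → e_r` when some u-arm is red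
and `¬ uP_r → ¬ e_r` when some u-arm is blue. -/
lemma not_leak_iff_pure (p : PtR ι ρ ν κ) :
    ¬ Leak p arm ↔ ∀ r, ((∃ j, p.1 j = true) → p.2.2.1 r = true → p.2.2.2.1 r = true) ∧
      ((∃ j, p.1 j = false) → p.2.2.1 r = false → p.2.2.2.1 r = false) := by
  simp only [Leak, leakArm_iff_pure, not_exists, not_or, not_and, Bool.not_eq_false,
    Bool.not_eq_true]

/-- A non-leaking point with a red u-arm has `uP ≤ e`. -/
lemma uP_le_e_of_red {p : PtR ι ρ ν κ} (hp : ¬ Leak p arm) (hs : ∃ j, p.1 j = true) :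
    p.2.2.1 ≤ p.2.2.2.1 := by
  intro r
  rw [Bool.le_iff_imp]
  exact ((not_leak_iff_pure p).1 hp r).1 hs

/-- A non-leaking point with a blue u-arm has `e ≤ uP`. -/
lemma e_le_uP_of_blue {p : PtR ι ρ ν κ} (hp : ¬ Leak p arm) (hs : ∃ j, p.1 j = false) :
    p.2.2.2.1 ≤ p.2.2.1 := by
  intro r
  rw [Bool.le_iff_imp]
  intro he
  by_contra hu
  have := ((not_leak_iff_pure p).1 hp r).2 hs (by simpa using hu)
  rw [he] at this
  exact absurd this (by decide)

/-- A point with `uP = e` does not leak. -/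
lemma not_leak_of_uP_eq_e {p : PtR ι ρ ν κ} (h : p.2.2.1 = p.2.2.2.1) : ¬ Leak p arm := by
  rw [not_leak_iff_pure]
  intro r
  rw [← h]
  exact ⟨fun _ hu => hu, fun _ hu => hu⟩

/-- A point with every u-arm red and `uP ≤ e` does not leak. -/
lemma not_leak_of_top_le {p : PtR ι ρ ν κ} (hs : ∀ j, p.1 j = true) (h : p.2.2.1 ≤ p.2.2.2.1) :
    ¬ Leak p arm := by
  rw [not_leak_iff_pure]
  intro r
  refine ⟨fun _ hu => ?_, fun ⟨j, hj⟩ => ?_⟩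
  · exact (Bool.le_iff_imp.1 (h r)) hu
  · rw [hs j] at hj
    exact absurd hj (by decide)

/-- A point with every u-arm blue and `e ≤ uP` does not leak. -/
lemma not_leak_of_bot_le {p : PtR ι ρ ν κ} (hs : ∀ j, p.1 j = false) (h : p.2.2.2.1 ≤ p.2.2.1) :
    ¬ Leak p arm := by
  rw [not_leak_iff_pure]
  intro r
  refine ⟨fun ⟨j, hj⟩ => ?_, fun _ hu => ?_⟩
  · rw [hs j] at hj
    exact absurd hj (by decide)
  · by_contra he
    have := (Bool.le_iff_imp.1 (h r)) (by simpa using he)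
    rw [hu] at this
    exact absurd this (by decide)

/-- A non-leaking point with a red u-arm and `uP ≠ e` has every u-arm red. -/
lemma top_of_red_of_ne {p : PtR ι ρ ν κ} (hp : ¬ Leak p arm) (hs : ∃ j, p.1 j = true)
    (hne : p.2.2.1 ≠ p.2.2.2.1) : ∀ j, p.1 j = true := by
  intro j
  by_contra hj
  exact hne (le_antisymm (uP_le_e_of_red hp hs)
    (e_le_uP_of_blue hp ⟨j, by simpa using hj⟩))

end Pure

section Moves

variable [IsEmpty ν] [Nonempty ι] {arm : ν → ρ} {Q : Set (PtR ι ρ ν κ)}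

/-- The set difference of two arm configurations: `e ∖ uP`. -/
def sdiffB (e uP : ρ → Bool) : ρ → Bool := fun r => e r && !uP r

/-- `e ∖ uP ≤ e`. -/
lemma sdiffB_le_left (e uP : ρ → Bool) : sdiffB e uP ≤ e := by
  intro r
  rw [Bool.le_iff_imp]
  intro h
  simp only [sdiffB, Bool.and_eq_true] at h
  exact h.1

/-- `e ∖ uP ≤ uPᶜ`. -/
lemma sdiffB_le_flip (e uP : ρ → Bool) : sdiffB e uP ≤ flipAll uP := by
  intro r
  rw [Bool.le_iff_imp]
  intro h
  simp only [sdiffB, Bool.and_eq_true] at h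
  exact h.2

/-- With `uP ≤ e`, `e = uP ∪ (e ∖ uP)`. -/
lemma sup_sdiffB {e uP : ρ → Bool} (h : uP ≤ e) : (fun r => uP r || sdiffB e uP r) = e := by
  funext r
  have hr := Bool.le_iff_imp.1 (h r)
  cases hu : uP r
  · simp [sdiffB, hu]
  · simp [sdiffB, hu, hr hu]

/-- With `uP ≤ e`, `e ∖ uP = ∅` iff `e = uP`. -/
lemma sdiffB_eq_bot_iff {e uP : ρ → Bool} (h : uP ≤ e) :
    sdiffB e uP = (fun _ => false) ↔ uP = e := by
  constructor
  · intro h0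
    rw [← sup_sdiffB h, h0]
    funext r
    simp
  · intro h0
    subst h0
    funext r
    simp [sdiffB]

/-- **The injection of the off-diagonal T-slab into the B-slab**:
`(⊤, A, B, f) ↦ (⊥, Aᶜ, B ∖ A, f)`. -/
def phiOff (p : PtR ι ρ ν κ) : PtR ι ρ ν κ :=
  ((fun _ => false), p.2.1, flipAll p.2.2.1, sdiffB p.2.2.2.1 p.2.2.1, p.2.2.2.2)

omit [IsEmpty ν] [Nonempty ι] in
/-- Raising `uP`: the form used below. -/
lemma mem_of_raise (hR : RaiseUP arm Q) {p : PtR ι ρ ν κ} (hp : p ∈ Q) (hpL : ¬ Leak p arm)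
    {uP : ρ → Bool} (hle : p.2.2.1 ≤ uP)
    (hqL : ¬ Leak (p.1, p.2.1, uP, p.2.2.2.1, p.2.2.2.2) arm) :
    (p.1, p.2.1, uP, p.2.2.2.1, p.2.2.2.2) ∈ Q :=
  hR p _ hpL hqL rfl rfl hle rfl rfl hp

omit [IsEmpty ν] [Nonempty ι] in
/-- Lowering from a point with a red u-arm to a point with a blue u-arm: every raw-lower move is
legal. -/
lemma mem_of_lower_red (hL : ArmLower arm Q) {p q : PtR ι ρ ν κ} (hp : p ∈ Q)
    (hpL : ¬ Leak p arm) (hs : ∃ j, p.1 j = true) (hqL : ¬ Leak q arm) (hle : q ≤ p)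
    (hs' : ∃ j, q.1 j = false) : q ∈ Q :=
  hL p q hpL hqL hle (fun _ => Or.inr ⟨hs, hs'⟩) hp

/-- A T-slab point `(⊤, A, B, f)` reaches its diagonal companion `(⊤, B, B, f)`. -/
lemma mem_top_diag (hR : RaiseUP arm Q) {p : PtR ι ρ ν κ} (hp : p ∈ Q) (hpL : ¬ Leak p arm)
    (hs : ∀ j, p.1 j = true) : (p.1, p.2.1, p.2.2.2.1, p.2.2.2.1, p.2.2.2.2) ∈ Q :=
  mem_of_raise hR hp hpL (uP_le_e_of_red hpL ⟨Classical.arbitrary ι, hs _⟩)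
    (not_leak_of_uP_eq_e rfl)

/-- **The injection lands in `Q`**: the image of a non-leaking T-slab point of `Q` is a
non-leaking B-slab point of `Q`. -/
lemma phiOff_mem (hL : ArmLower arm Q) (hR : RaiseUP arm Q) {p : PtR ι ρ ν κ} (hp : p ∈ Q)
    (hpL : ¬ Leak p arm) (hs : ∀ j, p.1 j = true) :
    phiOff p ∈ Q ∧ ¬ Leak (phiOff p) arm := by
  have h1 := mem_top_diag hR hp hpL hs
  -- the B-slab point `(⊥, B ∖ A, B ∖ A, f)`
  have h2 : ((fun _ => false), p.2.1, sdiffB p.2.2.2.1 p.2.2.1, sdiffB p.2.2.2.1 p.2.2.1,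
      p.2.2.2.2) ∈ Q := by
    refine mem_of_lower_red hL h1 (not_leak_of_uP_eq_e rfl) ⟨Classical.arbitrary ι, hs _⟩
      (not_leak_of_uP_eq_e rfl) ⟨fun j => Bool.false_le _, le_rfl, sdiffB_le_left _ _,
        sdiffB_le_left _ _, le_rfl⟩ ⟨Classical.arbitrary ι, rfl⟩
  have hL3 : ¬ Leak (phiOff p) arm :=
    not_leak_of_bot_le (fun _ => rfl) (sdiffB_le_flip _ _)
  exact ⟨mem_of_raise hR h2 (not_leak_of_uP_eq_e rfl) (sdiffB_le_flip _ _) hL3, hL3⟩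

omit [IsEmpty ν] [Nonempty ι] in
/-- The image of the injection is a B-slab point. -/
lemma phiOff_bot (p : PtR ι ρ ν κ) : ∀ j, (phiOff p).1 j = false := fun _ => rfl

/-- The image of an OFF-diagonal T-slab point has `e ≠ ⊥`. -/
lemma phiOff_e_ne_bot {p : PtR ι ρ ν κ} (hpL : ¬ Leak p arm) (hs : ∀ j, p.1 j = true)
    (hne : p.2.2.1 ≠ p.2.2.2.1) : (phiOff p).2.2.2.1 ≠ fun _ => false := by
  intro h
  exact hne ((sdiffB_eq_bot_iff (uP_le_e_of_red hpL ⟨Classical.arbitrary ι, hs _⟩)).1 h)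

omit [Nonempty ι] in
/-- **The `f`-frozen blue set of the image is the red set of the source.** -/
lemma EBT_phiOff [DecidableEq κ] {p : PtR ι ρ ν κ} (hs : ∀ j, p.1 j = true) :
    EBT ∅ (phiOff p) = ER p := by
  unfold EBT
  apply ER_eq_of_eq
  · funext j
    simp only [flipT, phiOff, flipAll, Bool.not_false, hs j]
  · exact Subsingleton.elim _ _
  · funext r
    simp only [flipT, phiOff, flipAll, Bool.not_not]
  · funext k
    simp only [flipT, phiOff, Finset.notMem_empty, if_false]

/-- **The injection is injective** on the T-slab. -/
lemma phiOff_inj {p q : PtR ι ρ ν κ} (hpL : ¬ Leak p arm) (hqL : ¬ Leak q arm)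
    (hsp : ∀ j, p.1 j = true) (hsq : ∀ j, q.1 j = true) (h : phiOff p = phiOff q) : p = q := by
  have hue : p.2.2.1 ≤ p.2.2.2.1 := uP_le_e_of_red hpL ⟨Classical.arbitrary ι, hsp _⟩
  have hue' : q.2.2.1 ≤ q.2.2.2.1 := uP_le_e_of_red hqL ⟨Classical.arbitrary ι, hsq _⟩
  obtain ⟨s, a, uP, e, f⟩ := p
  obtain ⟨s', a', uP', e', f'⟩ := q
  simp only [phiOff, Prod.mk.injEq] at h
  simp only at hsp hsq hue hue'
  obtain ⟨-, ha, hu, he, hf⟩ := h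
  have hu' : uP = uP' := flipAll_involutive.injective hu
  subst hu' ha hf
  have h1 : s = s' := by
    funext j
    rw [hsp j, hsq j]
  have h2 : e = e' := by
    rw [← sup_sdiffB hue, he, sup_sdiffB hue']
  rw [h1, h2]

omit [Nonempty ι] in
/-- **Realising a cube point with a blue u-arm**: a point of `Q` with a red u-arm reaches every
`(s, C, C, f')` below it (in `s`, `uP` and `f`) with a blue u-arm. -/
lemma mem_diag_of_red (hL : ArmLower arm Q) {p : PtR ι ρ ν κ} (hp : p ∈ Q)
    (hpL : ¬ Leak p arm) (hs : ∃ j, p.1 j = true) {s : Config ι} {C : ρ → Bool} {f : Config κ}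
    (hs1 : s ≤ p.1) (hC : C ≤ p.2.2.1) (hf : f ≤ p.2.2.2.2) (hs' : ∃ j, s j = false) :
    (s, p.2.1, C, C, f) ∈ Q :=
  mem_of_lower_red hL hp hpL hs (not_leak_of_uP_eq_e rfl)
    ⟨hs1, le_rfl, hC, le_trans hC (uP_le_e_of_red hpL hs), hf⟩ hs'

/-- **Realising a bottom cube point**: a point of `Q` with a red u-arm reaches every `(⊥, C, ⊥, f')`
with `f' ≤ f`. -/
lemma mem_botPt_of_red (hL : ArmLower arm Q) (hR : RaiseUP arm Q) {p : PtR ι ρ ν κ}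
    (hp : p ∈ Q) (hpL : ¬ Leak p arm) (hs : ∃ j, p.1 j = true) (C : ρ → Bool) {f : Config κ}
    (hf : f ≤ p.2.2.2.2) :
    ((fun _ => false), p.2.1, C, (fun _ => false), f) ∈ Q := by
  have h1 : ((fun _ => false), p.2.1, (fun _ => false), (fun _ => false), f) ∈ Q :=
    mem_diag_of_red hL hp hpL hs (fun _ => Bool.false_le _) (fun _ => Bool.false_le _) hf
      ⟨Classical.arbitrary ι, rfl⟩
  exact mem_of_raise hR h1 (not_leak_of_uP_eq_e rfl) (fun _ => Bool.false_le _)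
    (not_leak_of_bot_le (fun _ => rfl) (fun _ => Bool.false_le _))

end Moves

end MixedArms

end Summit.Ventures.PercRepro2
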